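import Literature.NumberTheory.EllipticCurves.ModularSymbolsCoefficients
import HarnessLib

/-!
# From modular symbols to cocycles: `Symb_{Γ₀(N)}(V) → Z¹(Γ₀(N), V)`, `U_p`-equivariantly

The bridge from the abstract modular symbols of `ModularSymbolsCoefficients` to the tree's
inhomogeneous cocycles (`HidaOrdinaryCohomologyCocycles.cocycles`, right modules:
`u(γδ) = u(δ) + ρ(δ) u(γ)`): for a `Γ₀(N)`-invariant symbol `φ` the function

  `toCocycle φ (γ) = φ(γ⁻¹·∞, ∞)`

is a cocycle for the coefficient action (`toCocycle_mem_cocyclesOn`: additivity at `∞, δ⁻¹∞, δ⁻¹γ⁻¹∞`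
plus invariance under `δ`), the map is linear (`toCocycleₗ`), and — the point of the construction —
**it intertwines the Hecke operator `Σᵢ (·|βᵢ)` on symbols with the tree's `U_p` on cochains**
(`toCocycle_hecke`: `βᵢ γ = γᵢ' β_{σ(i)}` (`gmat_heckePermElt_mul`), `βᵢ·∞ = ∞`, reindexing by the
permutation `σ = heckePermEquiv`).  For the coefficient system `Symⁿ` (`symPowOn`) the target is literally
the tree's `cocycles n N R` with its `heckeU` (`toCocycle_mem_cocycles`, `toCocycle_hecke_symPow`), which
makes the tree's Eichler–Shimura theory for cocycles (`HidaOrdinaryCohomologyEichlerShimura`) available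
to modular symbols (Shimura 1971, §8.1–8.3; Bellaïche 2021, §5.3).

Brick B3c' of the bottom-up plan recorded with the named fact
`greenbergStevens_kitagawa_twoVariable_interpolation_allBranches`.  Everything is proved; no named facts.

## References

* G. Shimura, *Introduction to the arithmetic theory of automorphic functions* (1971), §8.1–8.3.
  [Shimura1971]
* J. Bellaïche, *The Eigenbook* (2021), §5.3. [folklore]
-/

noncomputable section

open scoped MatrixGroups
open Matrix CongruenceSubgroup

namespace Literature.NumberTheory.EllipticCurves

open ModularForms ModularForms.HidaCohomology

namespace CoeffActionOn

/-! ### The cocycle of a function of pairs of cusps -/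

section ToCocycleDef

variable {V : Type*} {N : ℕ}

/-- **The cocycle of a function of pairs of cusps**: `u_φ(γ) = φ(γ⁻¹·∞, ∞)`. [cite: Shimura1971, §8.1] -/
def toCocycle (φ : P1Q → P1Q → V) (γ : Gamma0 N) : V := φ (P1Q.act (gmat γ⁻¹) P1Q.infty) P1Q.infty

/-- Unfolding `toCocycle`. [folklore] -/
theorem toCocycle_apply (φ : P1Q → P1Q → V) (γ : Gamma0 N) :
    toCocycle (N := N) φ γ = φ (P1Q.act (gmat γ⁻¹) P1Q.infty) P1Q.infty := rfl

variable {R : Type*} [CommRing R] [AddCommGroup V] [Module R V]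

variable (N R) in
/-- `toCocycle` as a linear map. [folklore] -/
def toCocycleₗ : (P1Q → P1Q → V) →ₗ[R] (Gamma0 N → V) where
  toFun φ := toCocycle φ
  map_add' _ _ := rfl
  map_smul' _ _ := rfl

/-- Unfolding `toCocycleₗ`. [folklore] -/
@[simp] theorem toCocycleₗ_apply (φ : P1Q → P1Q → V) : toCocycleₗ N R φ = toCocycle φ := rfl

end ToCocycleDef

variable {S : Set (Matrix (Fin 2) (Fin 2) ℤ)} {R V : Type*} [CommRing R] [AddCommGroup V] [Module R V]
  (A : CoeffActionOn S R V) {N : ℕ}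

/-! ### Cocycles for a coefficient system -/

variable (N) in
/-- **Inhomogeneous `1`-cocycles of `Γ₀(N)`** with values in the right module `(V, ρ)`:
`u(γδ) = u(δ) + ρ(δ) u(γ)` (the tree's `HidaOrdinaryCohomologyCocycles.cocycles` for general
coefficients). [cite: Shimura1971, §8.1] -/
def cocyclesOn : Submodule R (Gamma0 N → V) where
  carrier := {u | ∀ γ δ : Gamma0 N, u (γ * δ) = u δ + A.ρ (gmat δ) (u γ)}
  add_mem' := by
    intro u v hu hv γ δ
    simp only [Pi.add_apply, hu γ δ, hv γ δ, map_add]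
    abel
  zero_mem' := fun γ δ => by simp
  smul_mem' := by
    intro c u hu γ δ
    simp only [Pi.smul_apply, hu γ δ, smul_add, map_smul]

/-- Membership in `cocyclesOn`. [folklore] -/
theorem mem_cocyclesOn_iff {u : Gamma0 N → V} :
    u ∈ A.cocyclesOn N ↔ ∀ γ δ : Gamma0 N, u (γ * δ) = u δ + A.ρ (gmat δ) (u γ) := Iff.rfl

/-- For `Symⁿ` these are the tree's cocycles. [folklore] -/
theorem cocyclesOn_symPowOn (n : ℕ) :
    (symPowOn S n R).cocyclesOn N = HidaCohomology.cocycles n N R := rfl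

/-! ### The cocycle of a modular symbol -/

/-- The SL₂(ℤ)-matrix of `γ⁻¹` for `γ ∈ Γ₀(N)`. [folklore] -/
theorem gmat_inv_mul (γ : Gamma0 N) : gmat γ⁻¹ * gmat γ = 1 := by rw [← gmat_mul, inv_mul_cancel, gmat_one]

/-- `det (gmat γ) ≠ 0`. [folklore] -/
theorem det_gmat_ne_zero (γ : Gamma0 N) : (gmat γ).det ≠ 0 := by
  rw [show (gmat γ).det = 1 from (γ : SL(2, ℤ)).2]; exact one_ne_zero

/-- **The cocycle identity**: for `φ ∈ Symb_{Γ₀(N)}(V)`, `u_φ(γδ) = u_φ(δ) + ρ(δ) u_φ(γ)`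
(additivity at `∞, δ⁻¹∞, δ⁻¹γ⁻¹∞` and invariance under `δ`). [cite: Shimura1971, §8.1] -/
theorem toCocycle_mem_cocyclesOn {φ : P1Q → P1Q → V} (hφ : φ ∈ A.Symb (Gamma0 N)) :
    toCocycle φ ∈ A.cocyclesOn N := by
  intro γ δ
  have hadd := (mem_modSym_iff (R := R)).mp hφ.1
  -- invariance under `δ`: `φ(x, y) = ρ(δ) φ(δ x, δ y)`
  have hinv : ∀ x y, φ x y = A.ρ (gmat δ) (φ (P1Q.act (gmat δ) x) (P1Q.act (gmat δ) y)) := fun x y => by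
    have h := hφ.2 (δ : SL(2, ℤ)) δ.2
    exact (congrFun (congrFun h x) y).symm
  rw [toCocycle_apply, toCocycle_apply, toCocycle_apply, _root_.mul_inv_rev, gmat_mul,
    ← P1Q.act_act (det_gmat_ne_zero _) (det_gmat_ne_zero _)]
  -- `φ(δ⁻¹ γ⁻¹ ∞, ∞) = φ(δ⁻¹γ⁻¹∞, δ⁻¹∞) + φ(δ⁻¹∞, ∞)`
  rw [← hadd (P1Q.act (gmat δ⁻¹) (P1Q.act (gmat γ⁻¹) P1Q.infty)) (P1Q.act (gmat δ⁻¹) P1Q.infty) P1Q.infty, add_comm]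
  congr 1
  rw [hinv (P1Q.act (gmat δ⁻¹) (P1Q.act (gmat γ⁻¹) P1Q.infty)) (P1Q.act (gmat δ⁻¹) P1Q.infty),
    P1Q.act_act (det_gmat_ne_zero _) (det_gmat_ne_zero _), P1Q.act_act (det_gmat_ne_zero _) (det_gmat_ne_zero _),
    ← gmat_mul, mul_inv_cancel, gmat_one, P1Q.act_one]
  rfl

/-- For `Symⁿ`: the cocycle of a symbol is a cocycle in the tree's sense. [folklore] -/
theorem toCocycle_mem_cocycles {n : ℕ} {φ : P1Q → P1Q → Fin (n + 1) → R}
    (hφ : φ ∈ (symPowOn S n R).Symb (Gamma0 N)) : toCocycle φ ∈ HidaCohomology.cocycles n N R := by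
  rw [← cocyclesOn_symPowOn]
  exact (symPowOn S n R).toCocycle_mem_cocyclesOn hφ

/-! ### Hecke equivariance -/

section Hecke

variable {p : ℕ} [NeZero p] (hp : p.Prime)

omit [NeZero p] in
/-- The Hecke representatives fix `∞` (they are upper triangular). [folklore] -/
theorem act_heckeRep_infty (hp0 : p ≠ 0) (i : Option (ZMod p)) : P1Q.act (heckeRep p i) P1Q.infty = P1Q.infty := by
  have hdet : (heckeRep p i).det ≠ 0 := det_heckeRep_ne_zero hp0 i
  have hrat : (P1Q.ratMat (heckeRep p i)).det ≠ 0 := P1Q.det_ratMat_ne_zero hdet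
  rw [P1Q.infty, P1Q.act_eq _ hrat, Projectivization.map_mk]
  rw [Projectivization.mk_eq_mk_iff']
  cases i with
  | none =>
    refine ⟨(p : ℚ), ?_⟩
    funext j
    fin_cases j <;> simp [heckeRep, Matrix.toLin'_apply, Matrix.mulVec, dotProduct, Fin.sum_univ_two]
  | some a =>
    refine ⟨1, ?_⟩
    funext j
    fin_cases j <;> simp [heckeRep, Matrix.toLin'_apply, Matrix.mulVec, dotProduct, Fin.sum_univ_two]

omit [NeZero p] in
/-- **`γᵢ'⁻¹ · ∞ = β_{σ(i)} γ⁻¹ · ∞`** from `βᵢ γ = γᵢ' β_{σ(i)}` and `βᵢ·∞ = ∞`. [folklore] -/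
theorem act_heckePermElt_inv_infty (γ : Gamma0 N) (i : HeckeIdx N p) :
    P1Q.act (gmat (heckePermElt hp γ i)⁻¹) P1Q.infty =
      P1Q.act (heckeRep p (heckePerm hp γ i).1) (P1Q.act (gmat γ⁻¹) P1Q.infty) := by
  have hβ : ∀ j : Option (ZMod p), (heckeRep p j).det ≠ 0 := fun j => det_heckeRep_ne_zero hp.ne_zero j
  have hrel := gmat_heckePermElt_mul hp γ i
  -- multiply `γᵢ' β_{σ i} = βᵢ γ` on the left by `γᵢ'⁻¹` and on the right by `γ⁻¹`
  have hrel' : heckeRep p (heckePerm hp γ i).1 * gmat γ⁻¹ = gmat (heckePermElt hp γ i)⁻¹ * heckeRep p i.1 := by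
    have h1 : gmat (heckePermElt hp γ i)⁻¹ * (gmat (heckePermElt hp γ i) * heckeRep p (heckePerm hp γ i).1) * gmat γ⁻¹ =
        gmat (heckePermElt hp γ i)⁻¹ * (heckeRep p i.1 * gmat γ) * gmat γ⁻¹ := by rw [hrel]
    rwa [← mul_assoc, gmat_inv_mul, one_mul, mul_assoc, mul_assoc, ← gmat_mul, mul_inv_cancel, gmat_one, mul_one] at h1
  rw [P1Q.act_act (hβ _) (det_gmat_ne_zero _), hrel', ← P1Q.act_act (det_gmat_ne_zero _) (hβ _),
    act_heckeRep_infty hp.ne_zero]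

/-- **`toCocycle` intertwines the Hecke operators**: `u_{φ|Σβᵢ}(γ) = Σᵢ ρ(β_{σ i}) u_φ(γᵢ')`.
[cite: Shimura1971, §8.3 (8.3.2)] -/
theorem toCocycle_hecke (φ : P1Q → P1Q → V) (γ : Gamma0 N) :
    toCocycle (A.hecke N p φ) γ =
      ∑ i : HeckeIdx N p, A.ρ (heckeRep p (heckePerm hp γ i).1) (toCocycle φ (heckePermElt hp γ i)) := by
  rw [toCocycle_apply, A.hecke_apply, Finset.sum_apply, Finset.sum_apply]
  -- reindex the left sum by the permutation `σ_γ`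
  rw [← (heckePermEquiv hp γ).sum_comp]
  refine Finset.sum_congr rfl fun i _ => ?_
  rw [heckePermEquiv_apply, A.slash_apply, toCocycle_apply, act_heckePermElt_inv_infty hp, act_heckeRep_infty hp.ne_zero]

/-- For `Symⁿ`: **`toCocycle ∘ (Σᵢ ·|βᵢ) = U_p ∘ toCocycle`** with the tree's `heckeU`. [cite: Shimura1971, §8.3] -/
theorem toCocycle_hecke_symPow {n : ℕ} (φ : P1Q → P1Q → Fin (n + 1) → R) :
    toCocycle ((symPowOn S n R).hecke N p φ) = HidaCohomology.heckeU n N R hp (toCocycle φ) := by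
  funext γ
  rw [(symPowOn S n R).toCocycle_hecke hp, HidaCohomology.heckeU_apply]
  rfl

end Hecke

end CoeffActionOn

end Literature.NumberTheory.EllipticCurves

end
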